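import Summits.BirchSwinnertonDyer.Rank1Residual.WAll.AltClosersResidualCells
import HarnessLib

/-!
# Rung W-ALL (D-0120), row 4 (corner X1): the UNBALANCED rank-`0` cell in `BSD(E,p)` currency — the
# weakest residual that still lets the eis route close the row (cell `bsd-wall`, lane 2, seat ty-2)

HONEST FRAMING (cell `bsd-wall`, run/shared/lean/pub/bsd-wall/; WALL-BRIEF-v1 §2; companion of
`WAll/AltClosersResidualCells.lean` §1, same rules: NOTHING ASSERTED, no `def`, no `@[conjecture]`,
no named fact, NO ROUTE FILE IMPORTED). The route sketch `RealTwistEisenstein` (seat bsd-wall-eis,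
HOME/bsd-wall-eis/Sketch.lean sha16 06633b27cf8952b3) declares its residual `UnbalancedRankZeroResidual`
in CERTIFICATE currency: every rank-`0` X1 leaf pair OFF the balanced Mazur class carries the
double-twist certificate `X1.RankZeroDoubleTwist.DoubleTwistPartnerAt` (two admissible fields, a
rank-one twist, a double twist with `L(·,1) ≠ 0` and an isogenous curve with `p ∤ #Ш_an`). That
statement is NOT a consequence of `WAll` (it is a `μ`-type indivisibility, class-wide not in print —
`X1/RankZeroDoubleTwistTransport.lean` §4), so as a residual it is STRONGER than the slice of row 4 it
stands for. This file records the Theses-free bookkeeping showing that the route may declare the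
WEAKER residual "`BSD(E,p)` at every unbalanced rank-`0` X1 leaf pair" (`BSD(E,p)` currency, a literal
slice of `WAllCornerX1`, hence implied by it: `unbalancedRankZeroBSDp_of_wallCornerX1`) and still
close the row: on the BALANCED class the certificate gives `BSD(E,p)` PER PAIR from `h308` + PUB
(`X1.RankZeroDoubleTwistTransport.Leaf.bsdp_of_h308_of_doubleTwistPartnerAt`: Ribet's lemma supplies
the good lattice, the datum transports along the isogeny, Cassels), so the rank-`0` leaf statement —
and with it the full rank-`0` supply the type-B rank-`1` road consumes — follows from `h308` + the
balanced certificate cell + the unbalanced `BSD(E,p)` cell + PUB.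

* `x1RankZeroStatement_of_h308_of_balancedCertificate_of_unbalancedBSDp` — row A3 from `h308` + the
  balanced certificate cell + the unbalanced cell in `BSD(E,p)` currency + PUB;
* `unbalancedRankZeroBSDp_of_bsdpOnClassX1`, `unbalancedRankZeroBSDp_of_wallCornerX1` — the weakened
  residual is a slice of K5's X1 conjunct `BSDpOnClassX1` / of row 4 (exact; by name);
* `unbalancedRankZeroBSDp_of_h308_of_unbalancedCertificate` — and is implied by the route's
  certificate-currency residual (granted `h308` + PUB), so nothing is lost by weakening;
* `wallCornerX1_of_h308_of_balancedCertificate_of_unbalancedBSDp_of_typeBLeaf` — ROW 4 from `h308` +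
  balanced certificate cell + unbalanced `BSD(E,p)` cell + the registered rung-I1 leaf
  `SchneiderWeaken.TypeBRankOneUnridered` + PUB (type-A rank `1` = Keller–Yin Theorem A, tree theorem).

References: WALL-BRIEF-v1.md §2–§3; HOME/bsd-wall-eis/Sketch.lean; `X1/RankZero.lean`,
`X1/RankZeroDoubleTwist.lean`, `X1/RankZeroDoubleTwistTransport.lean`, `X1/KellerYinTheoremAClass.lean`,
`Theorems/SchneiderWeakenLeaf.lean`; [cite: KellerYin2024, Thm. 3.0.8 (IMC2) and Thm. 4.2.1 (claim,
under review)]; [cite: Ribet1976, Prop. 2.1]; [cite: Wuthrich2014, Prop. 21 (p. 400)];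
[cite: Miller2011LMS, §1 and Def. 1.1].
-/

noncomputable section

open scoped Classical

open WeierstrassCurve Literature.NumberTheory.EllipticCurves
  Literature.NumberTheory.EllipticCurves.Rank1Residual
  Literature.NumberTheory.EllipticCurves.Wuthrich2014
  Literature.NumberTheory.EllipticCurves.ModularForms
  Literature.NumberTheory.EllipticCurves.CastellaGrossiLeeSkinner2022
  Literature.NumberTheory.EllipticCurves.KellerYin2024

set_option autoImplicit false

namespace Summit.BirchSwinnertonDyer.Rank1Residual.WAll

open Summit.BirchSwinnertonDyer
open Summit.BirchSwinnertonDyer.BirchSwinnertonDyer.Theorems.Rank1ResidualX1Defs (BSDpOnClassX1)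
open Summit.BirchSwinnertonDyer.BirchSwinnertonDyer.Theorems.SchneiderWeaken (TypeBRankOneUnridered)
open Summit.BirchSwinnertonDyer.Rank1Residual.X1.RankZeroDoubleTwist (DoubleTwistPartnerAt)

/-- **Row A3 (`X1.RankZero.Statement`) from `h308` + the BALANCED certificate cell + the UNBALANCED
cell in `BSD(E,p)` currency + PUB.** On a balanced pair the certificate gives `BSD(E,p)` per pair by
`X1.RankZeroDoubleTwistTransport.Leaf.bsdp_of_h308_of_doubleTwistPartnerAt` (KY Thm. 3.0.8 (IMC2) at
`𝟙` for the good lattice `h308`, PRE; CGLS 5.1.1 `h511`, Wuthrich Prop. 21 `hW`, Cassels `hCassels`,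
modularity `hmodP`/`hmod`, Gross–Zagier `hGZQ`/`hGZ`, Kolyvagin `hKo`, GZK); off the balanced class the
cell is the statement itself. CONDITIONAL; nothing closed. [claim: KellerYin2024, status: under-review]
[cite: KellerYin2024, Thm. 3.0.8 (IMC2), Prop. 1.3.1] [cite: Wuthrich2014, Prop. 21 (p. 400)] -/
theorem x1RankZeroStatement_of_h308_of_balancedCertificate_of_unbalancedBSDp
    (h308 : thm308_imc2_bdpValue_goodLattice_OPEN)
    (hBal : ∀ (W : WeierstrassCurve ℚ) [W.IsElliptic] [W.IsGloballyMinimal] (p : ℕ) [Fact p.Prime],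
      X1.RankZero.Leaf W p →
      (Squarefree (W.conductorNorm ℤ) ∧
        ∃ (W' : WeierstrassCurve ℚ) (_ : W'.IsElliptic) (_ : W'.IsGloballyMinimal),
          IsIsogenous W W' ∧ p ∣ W'.torsionOrder ∧ padicValNat p W'.tamagawaProduct = 1) →
      DoubleTwistPartnerAt W p)
    (hUnb : ∀ (W : WeierstrassCurve ℚ) [W.IsElliptic] [W.IsGloballyMinimal] (p : ℕ) [Fact p.Prime],
      X1.RankZero.Leaf W p →
      ¬ (Squarefree (W.conductorNorm ℤ) ∧
        ∃ (W' : WeierstrassCurve ℚ) (_ : W'.IsElliptic) (_ : W'.IsGloballyMinimal),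
          IsIsogenous W W' ∧ p ∣ W'.torsionOrder ∧ padicValNat p W'.tamagawaProduct = 1) →
      BSDp W p)
    (h511 : thm511_anticyclotomicControl_of_torsionFree)
    (hW : sha_dvd_analyticSha) (hCassels : bsdRHS_eq_of_isIsogenous)
    (hmodP : nonempty_modularParametrizationData) (hmod : exists_isNewformOf)
    (hGZQ : GrossZagier1986_thm_I_7_3)
    (hGZ : ∀ (N : ℕ) [NeZero N] (W : WeierstrassCurve ℚ) (K : Type) [Field K] [NumberField K],
      gross_zagier N W K)
    (hKo : ∀ (N : ℕ) [NeZero N] (W : WeierstrassCurve ℚ) (K : Type) [Field K] [NumberField K],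
      kolyvagin N W K)
    (hGZK : rank_eq_analyticRank_of_analyticRank_le_one) : X1.RankZero.Statement := by
  intro V _ _ p _ hL
  by_cases hB : (Squarefree (V.conductorNorm ℤ) ∧
      ∃ (W' : WeierstrassCurve ℚ) (_ : W'.IsElliptic) (_ : W'.IsGloballyMinimal),
        IsIsogenous V W' ∧ p ∣ W'.torsionOrder ∧ padicValNat p W'.tamagawaProduct = 1)
  · exact X1.RankZeroDoubleTwistTransport.Leaf.bsdp_of_h308_of_doubleTwistPartnerAt h308 h511 hW
      hCassels hmodP hmod hGZQ hGZ hKo hGZK V hL (hBal V p hL hB)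
  · exact hUnb V p hL hB

/-- **The unbalanced `BSD(E,p)` cell is a slice of K5's X1 conjunct `BSDpOnClassX1`** (by name).
[folklore] -/
theorem unbalancedRankZeroBSDp_of_bsdpOnClassX1 (h : BSDpOnClassX1) :
    ∀ (W : WeierstrassCurve ℚ) [W.IsElliptic] [W.IsGloballyMinimal] (p : ℕ) [Fact p.Prime],
      X1.RankZero.Leaf W p →
      ¬ (Squarefree (W.conductorNorm ℤ) ∧
        ∃ (W' : WeierstrassCurve ℚ) (_ : W'.IsElliptic) (_ : W'.IsGloballyMinimal),
          IsIsogenous W W' ∧ p ∣ W'.torsionOrder ∧ padicValNat p W'.tamagawaProduct = 1) →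
      BSDp W p :=
  fun W _ _ p _ hL _ ↦ X1.RankZero.statement_of_bsdpOnClassX1 h W p hL

/-- **… and of row 4 `WAllCornerX1`** (through `bsdpOnClassX1_of_wallCornerX1`: a class-X1 pair is
non-CM), unconditionally — so, unlike the certificate-currency residual, the `BSD(E,p)`-currency
residual is EXACT. [cite: Mazur1978, §6 Prop. 6.3 (1) (p. 153)] -/
theorem unbalancedRankZeroBSDp_of_wallCornerX1 (h : WAllCornerX1) :
    ∀ (W : WeierstrassCurve ℚ) [W.IsElliptic] [W.IsGloballyMinimal] (p : ℕ) [Fact p.Prime],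
      X1.RankZero.Leaf W p →
      ¬ (Squarefree (W.conductorNorm ℤ) ∧
        ∃ (W' : WeierstrassCurve ℚ) (_ : W'.IsElliptic) (_ : W'.IsGloballyMinimal),
          IsIsogenous W W' ∧ p ∣ W'.torsionOrder ∧ padicValNat p W'.tamagawaProduct = 1) →
      BSDp W p :=
  unbalancedRankZeroBSDp_of_bsdpOnClassX1 (bsdpOnClassX1_of_wallCornerX1 h)

/-- **Nothing is lost by weakening**: granted `h308` + PUB, the route's certificate-currency residual
`UnbalancedRankZeroResidual` implies the `BSD(E,p)`-currency cell (per pair,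
`X1.RankZeroDoubleTwistTransport.Leaf.bsdp_of_h308_of_doubleTwistPartnerAt`). CONDITIONAL; nothing
closed. [claim: KellerYin2024, status: under-review] [cite: KellerYin2024, Thm. 3.0.8 (IMC2)]
[cite: Wuthrich2014, Prop. 21 (p. 400)] -/
theorem unbalancedRankZeroBSDp_of_h308_of_unbalancedCertificate
    (h308 : thm308_imc2_bdpValue_goodLattice_OPEN)
    (hUnbC : ∀ (W : WeierstrassCurve ℚ) [W.IsElliptic] [W.IsGloballyMinimal] (p : ℕ) [Fact p.Prime],
      X1.RankZero.Leaf W p →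
      ¬ (Squarefree (W.conductorNorm ℤ) ∧
        ∃ (W' : WeierstrassCurve ℚ) (_ : W'.IsElliptic) (_ : W'.IsGloballyMinimal),
          IsIsogenous W W' ∧ p ∣ W'.torsionOrder ∧ padicValNat p W'.tamagawaProduct = 1) →
      DoubleTwistPartnerAt W p)
    (h511 : thm511_anticyclotomicControl_of_torsionFree)
    (hW : sha_dvd_analyticSha) (hCassels : bsdRHS_eq_of_isIsogenous)
    (hmodP : nonempty_modularParametrizationData) (hmod : exists_isNewformOf)
    (hGZQ : GrossZagier1986_thm_I_7_3)
    (hGZ : ∀ (N : ℕ) [NeZero N] (W : WeierstrassCurve ℚ) (K : Type) [Field K] [NumberField K],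
      gross_zagier N W K)
    (hKo : ∀ (N : ℕ) [NeZero N] (W : WeierstrassCurve ℚ) (K : Type) [Field K] [NumberField K],
      kolyvagin N W K)
    (hGZK : rank_eq_analyticRank_of_analyticRank_le_one) :
    ∀ (W : WeierstrassCurve ℚ) [W.IsElliptic] [W.IsGloballyMinimal] (p : ℕ) [Fact p.Prime],
      X1.RankZero.Leaf W p →
      ¬ (Squarefree (W.conductorNorm ℤ) ∧
        ∃ (W' : WeierstrassCurve ℚ) (_ : W'.IsElliptic) (_ : W'.IsGloballyMinimal),
          IsIsogenous W W' ∧ p ∣ W'.torsionOrder ∧ padicValNat p W'.tamagawaProduct = 1) →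
      BSDp W p :=
  fun V _ _ p _ hL hB ↦
    X1.RankZeroDoubleTwistTransport.Leaf.bsdp_of_h308_of_doubleTwistPartnerAt h308 h511 hW hCassels
      hmodP hmod hGZQ hGZ hKo hGZK V hL (hUnbC V p hL hB)

/-- **ROW 4 `WAllCornerX1` from `h308` + the BALANCED certificate cell (the eis route's deciding
purchase) + the UNBALANCED cell in `BSD(E,p)` currency (the weakest workable residual) + the
registered rung-I1 leaf `SchneiderWeaken.TypeBRankOneUnridered` + PUB**; type-A rank `1` is
Keller–Yin Theorem A (`X1.KellerYinTheoremA.forall_bsdp_classX1_typeA_rankOne`, tree theorem, `h308`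
+ PUB). CONDITIONAL; nothing closed. [claim: KellerYin2024, status: under-review]
[cite: KellerYin2024, Thm. 3.0.8 (IMC2) and Thm. 4.2.1] [cite: GreenbergVatsal2000, Thm. (1.3)]
[cite: Wuthrich2014, Prop. 21 (p. 400)] -/
theorem wallCornerX1_of_h308_of_balancedCertificate_of_unbalancedBSDp_of_typeBLeaf
    (h308 : thm308_imc2_bdpValue_goodLattice_OPEN)
    (hBal : ∀ (W : WeierstrassCurve ℚ) [W.IsElliptic] [W.IsGloballyMinimal] (p : ℕ) [Fact p.Prime],
      X1.RankZero.Leaf W p →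
      (Squarefree (W.conductorNorm ℤ) ∧
        ∃ (W' : WeierstrassCurve ℚ) (_ : W'.IsElliptic) (_ : W'.IsGloballyMinimal),
          IsIsogenous W W' ∧ p ∣ W'.torsionOrder ∧ padicValNat p W'.tamagawaProduct = 1) →
      DoubleTwistPartnerAt W p)
    (hUnb : ∀ (W : WeierstrassCurve ℚ) [W.IsElliptic] [W.IsGloballyMinimal] (p : ℕ) [Fact p.Prime],
      X1.RankZero.Leaf W p →
      ¬ (Squarefree (W.conductorNorm ℤ) ∧
        ∃ (W' : WeierstrassCurve ℚ) (_ : W'.IsElliptic) (_ : W'.IsGloballyMinimal),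
          IsIsogenous W W' ∧ p ∣ W'.torsionOrder ∧ padicValNat p W'.tamagawaProduct = 1) →
      BSDp W p)
    (hB : TypeBRankOneUnridered)
    (h511 : thm511_anticyclotomicControl_of_torsionFree)
    (hW : sha_dvd_analyticSha) (hCassels : bsdRHS_eq_of_isIsogenous)
    (hGV : GreenbergVatsal2000.thm13_charIdeal_eq_of_gvPar) (hGr : greenberg_charValue_rankZero)
    (hmodP : nonempty_modularParametrizationData) (hmod : exists_isNewformOf)
    (hHL : HoffsteinLuo1997_exists_twist_L_one_ne_zero) (hGZQ : GrossZagier1986_thm_I_7_3)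
    (hGZ : ∀ (N : ℕ) [NeZero N] (W : WeierstrassCurve ℚ) (K : Type) [Field K] [NumberField K],
      gross_zagier N W K)
    (hKo : ∀ (N : ℕ) [NeZero N] (W : WeierstrassCurve ℚ) (K : Type) [Field K] [NumberField K],
      kolyvagin N W K)
    (hGZK : rank_eq_analyticRank_of_analyticRank_le_one) : WAllCornerX1 :=
  wallCornerX1_of_x1Statements
    (x1RankZeroStatement_of_h308_of_balancedCertificate_of_unbalancedBSDp h308 hBal hUnb h511 hW
      hCassels hmodP hmod hGZQ hGZ hKo hGZK)
    (x1RankOneStatement_of_typeA_of_typeBLeaf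
      (X1.KellerYinTheoremA.forall_bsdp_classX1_typeA_rankOne h308 h511 hCassels hGV hGr hmodP hmod
        hHL hGZQ hGZ hKo hGZK)
      hB)

end Summit.BirchSwinnertonDyer.Rank1Residual.WAll

end
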